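import Summits.NavierStokesRegularity.NavierStokesRegularity.Theorems.SelfMixingDichotomyMixingPayoffMassExport
import HarnessLib

/-!
# Crux `MixingPayoff` (stmt-NavierStokesRegularity-1422), line `birth`: corollaries of mass export
# for the open heart H (`stub_mixingForcesTypeI`)

Support file (`--supports stmt-NavierStokesRegularity-1422`). The landed theorem
`mixingPayoff_massExport` says: there are absolute `δ₀, c > 0` such that for a standing solution,
`0 < r`, `r² < T`, `0 < δ ≤ δ₀`, the mixing hypothesis `DissipatesAtScale u T x₀ r δ` forces
`‖u t x‖ ≥ c δ^{-2/3}/r` at some `t ∈ [T − r², T − r²/2]`, `x ∈ B̄(x₀, r δ^{-2/3})`.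
Letting `r → 0` along a cofinally mixing family of scales gives three structural facts about the
open heart H ("cofinal `δ`-mixing at `(T, x₀)` ⇒ Type-I(K) at `(T, x₀)`") of line `birth`:

* `mixingPayoff_typeIRatio_lower_bound` — a cofinally `δ`-mixing point (`δ ≤ δ₀`) has Type-I
  ratio `√(T − t)‖u(t,x)‖ ≥ (c/√2) δ^{-2/3}` somewhere in EVERY parabolic cylinder
  `(T − r₁², T) × B(x₀, r₁)` (on the window `√(T − t) ≥ r/√2`);
* `mixingPayoff_not_cofinallyMixing_of_bounded` — a point near which `u` is bounded is never
  cofinally `δ`-mixing for `δ ≤ δ₀` (so the hypothesis of the crux forces a singular point; this is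
  the refuter's crux-attack facts (a)/(c) made rigorous with an explicit threshold);
* `mixingPayoff_typeI_constant_lower_bound` — if a cofinally `δ`-mixing point obeys the Type-I(K)
  bound of H's conclusion then `K ≥ (c/√2) δ^{-2/3}`: the constant `K` of H cannot be chosen
  independently of `δ` (consistency constraint `K ≳ δ^{-2/3}` recorded on the item).

No named fact is taken as a hypothesis: everything is unconditional.
-/

noncomputable section

open Literature.Analysis.FluidPDE MeasureTheory Set Function Metric
open scoped ContDiff

-- `Summit = Problem` for this summit; the tree lakefile sets `weak.linter.dupNamespace = false`,
-- made explicit here for out-of-tree `lean check`.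
set_option linter.dupNamespace false

namespace Summit.NavierStokesRegularity.NavierStokesRegularity.Theorems

local notation "E3" => EuclideanSpace ℝ (Fin 3)

/-- **Type-I ratio lower bound at cofinally mixing points.** There are absolute `δ₀, c' > 0`
(`c' = c/√2` with `c` from `mixingPayoff_massExport`) such that: if a standing solution is
cofinally `δ`-mixing at `(T, x₀)` with `0 < δ ≤ δ₀`, then every parabolic cylinder
`(T − r₁², T) × B(x₀, r₁)` contains a point with `√(T − t) ‖u t x‖ ≥ c' δ^{-2/3}`. Proof: apply
mass export at a scale `r < min r₀ r₁` with `r² < T` and `r δ^{-2/3} < r₁`; on the window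
`T − t ≥ r²/2`, so `√(T − t) ≥ r/√2`. -/
theorem mixingPayoff_typeIRatio_lower_bound :
    ∃ δ₀ : ℝ, 0 < δ₀ ∧ ∃ c' : ℝ, 0 < c' ∧
    ∀ (T : ℝ) (u : ℝ → E3 → E3) (p : ℝ → E3 → ℝ), 0 < T →
    IsClassicalNSSolutionOn (Set.Ico 0 T) 1 0 u p → IsLerayHopfOn T 1 0 (u 0) u →
    HasRapidSpatialDecay (u 0) →
    ∀ (x₀ : E3) (δ : ℝ), 0 < δ → δ ≤ δ₀ →
    (∃ r₀ : ℝ, 0 < r₀ ∧ ∀ r ∈ Set.Ioo 0 r₀, DissipatesAtScale u T x₀ r δ) →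
    ∀ r₁ : ℝ, 0 < r₁ → ∃ t ∈ Set.Ioo (T - r₁ ^ 2) T, ∃ x ∈ Metric.ball x₀ r₁,
      c' * δ ^ (-(2:ℝ) / 3) ≤ Real.sqrt (T - t) * ‖u t x‖ := by
  obtain ⟨δ₀, hδ₀, c, hc, hME⟩ := mixingPayoff_massExport
  refine ⟨δ₀, hδ₀, c / Real.sqrt 2, by positivity, ?_⟩
  intro T u p hT hcl hLH hdec x₀ δ hδ hδδ₀ hmix r₁ hr₁
  obtain ⟨r₀, hr₀, hmix⟩ := hmix
  set s : ℝ := δ ^ (-(2:ℝ) / 3) with hs_def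
  have hs : 0 < s := Real.rpow_pos_of_pos hδ _
  -- a scale `r` below `r₀`, `r₁ / s`, `r₁` and `√T`
  obtain ⟨r, hr, hrr₀, hrs, hrr₁, hrT⟩ :
      ∃ r : ℝ, 0 < r ∧ r < r₀ ∧ r * s < r₁ ∧ r < r₁ ∧ r ^ 2 < T := by
    have hm : 0 < min (min r₀ (r₁ / (s + 1))) (min r₁ (Real.sqrt T)) :=
      lt_min (lt_min hr₀ (by positivity)) (lt_min hr₁ (Real.sqrt_pos.2 hT))
    set m := min (min r₀ (r₁ / (s + 1))) (min r₁ (Real.sqrt T)) with hm_def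
    have h₁ : m ≤ r₀ := (min_le_left _ _).trans (min_le_left _ _)
    have h₂ : m ≤ r₁ / (s + 1) := (min_le_left _ _).trans (min_le_right _ _)
    have h₃ : m ≤ r₁ := (min_le_right _ _).trans (min_le_left _ _)
    have h₄ : m ≤ Real.sqrt T := (min_le_right _ _).trans (min_le_right _ _)
    have hsq : Real.sqrt T ^ 2 = T := Real.sq_sqrt hT.le
    refine ⟨m / 2, by positivity, by linarith, ?_, by linarith, by nlinarith [Real.sqrt_nonneg T]⟩
    have h5 : m / 2 * s ≤ r₁ / (s + 1) * s / 2 := by nlinarith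
    have h6 : r₁ / (s + 1) * s < r₁ := by
      rw [div_mul_eq_mul_div, div_lt_iff₀ (by positivity)]
      nlinarith
    linarith
  obtain ⟨t, ht, x, hx, hux⟩ :=
    hME T u p hT hcl hLH hdec x₀ r δ hr hrT hδ hδδ₀ (hmix r ⟨hr, hrr₀⟩)
  refine ⟨t, ⟨?_, ?_⟩, x, ?_, ?_⟩
  · have : r ^ 2 < r₁ ^ 2 := by nlinarith
    linarith [ht.1]
  · nlinarith [ht.2]
  · rw [Metric.mem_ball]
    exact lt_of_le_of_lt (Metric.mem_closedBall.1 hx) (by rw [← hs_def]; exact hrs)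
  · -- on the window `√(T - t) ≥ r / √2`
    have hTt : r ^ 2 / 2 ≤ T - t := by linarith [ht.2]
    have hsqrt2 : 0 < Real.sqrt 2 := Real.sqrt_pos.2 (by norm_num)
    have hroot : r / Real.sqrt 2 ≤ Real.sqrt (T - t) := by
      rw [div_le_iff₀ hsqrt2, ← Real.sqrt_mul_self hr.le, ← Real.sqrt_mul (sub_nonneg.2 (by nlinarith [sq_nonneg r]))]
      exact Real.sqrt_le_sqrt (by nlinarith)
    have hu0 : 0 ≤ ‖u t x‖ := norm_nonneg _
    calc c / Real.sqrt 2 * δ ^ (-(2:ℝ) / 3) = (r / Real.sqrt 2) * (c * δ ^ (-(2:ℝ) / 3) / r) := by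
          field_simp
      _ ≤ Real.sqrt (T - t) * ‖u t x‖ :=
          mul_le_mul hroot hux (by positivity) (Real.sqrt_nonneg _)

/-- **Regular points are not cofinally mixing.** There is an absolute `δ₀ > 0` such that at a point
`(T, x₀)` near which a standing solution is bounded (`‖u‖ ≤ M` on `(T − ρ², T) × B(x₀, ρ)`), the
drift is NOT cofinally `δ`-mixing for any `0 < δ ≤ δ₀`: by `mixingPayoff_typeIRatio_lower_bound`
the cylinder of radius `min ρ (c' δ^{-2/3}/(max M 0 + 1))` would contain a point with
`c' δ^{-2/3} ≤ √(T − t)‖u‖ < c' δ^{-2/3}`. Hence the hypothesis of the crux `MixingPayoff`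
(for `δ ≤ δ₀`) can only hold at a singular point. -/
theorem mixingPayoff_not_cofinallyMixing_of_bounded :
    ∃ δ₀ : ℝ, 0 < δ₀ ∧
    ∀ (T : ℝ) (u : ℝ → E3 → E3) (p : ℝ → E3 → ℝ), 0 < T →
    IsClassicalNSSolutionOn (Set.Ico 0 T) 1 0 u p → IsLerayHopfOn T 1 0 (u 0) u →
    HasRapidSpatialDecay (u 0) → ∀ x₀ : E3,
    (∃ ρ : ℝ, 0 < ρ ∧ ∃ M : ℝ, ∀ t ∈ Set.Ioo (T - ρ ^ 2) T, ∀ x ∈ Metric.ball x₀ ρ, ‖u t x‖ ≤ M) →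
    ∀ δ : ℝ, 0 < δ → δ ≤ δ₀ →
    ¬ (∃ r₀ : ℝ, 0 < r₀ ∧ ∀ r ∈ Set.Ioo 0 r₀, DissipatesAtScale u T x₀ r δ) := by
  obtain ⟨δ₀, hδ₀, c', hc', hLB⟩ := mixingPayoff_typeIRatio_lower_bound
  refine ⟨δ₀, hδ₀, ?_⟩
  intro T u p hT hcl hLH hdec x₀ hbdd δ hδ hδδ₀ hmix
  obtain ⟨ρ, hρ, M, hM⟩ := hbdd
  set s : ℝ := δ ^ (-(2:ℝ) / 3) with hs_def
  have hs : 0 < s := Real.rpow_pos_of_pos hδ _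
  have hM0 : 0 < max M 0 + 1 := by positivity
  -- the cylinder of radius `r₁ = min ρ (c' s / (max M 0 + 1))`
  set r₁ : ℝ := min ρ (c' * s / (max M 0 + 1)) with hr₁_def
  have hr₁ : 0 < r₁ := lt_min hρ (by positivity)
  have hr₁ρ : r₁ ≤ ρ := min_le_left _ _
  have hr₁s : r₁ * (max M 0 + 1) ≤ c' * s := by
    have h := min_le_right ρ (c' * s / (max M 0 + 1))
    rw [← hr₁_def] at h
    calc r₁ * (max M 0 + 1) ≤ c' * s / (max M 0 + 1) * (max M 0 + 1) :=
          mul_le_mul_of_nonneg_right h hM0.le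
      _ = c' * s := by field_simp
  obtain ⟨t, ht, x, hx, hux⟩ := hLB T u p hT hcl hLH hdec x₀ δ hδ hδδ₀ hmix r₁ hr₁
  have htρ : t ∈ Set.Ioo (T - ρ ^ 2) T := by
    refine ⟨lt_of_le_of_lt ?_ ht.1, ht.2⟩
    nlinarith [pow_le_pow_left₀ hr₁.le hr₁ρ 2]
  have hxρ : x ∈ Metric.ball x₀ ρ := Metric.ball_subset_ball hr₁ρ hx
  have hub : ‖u t x‖ ≤ max M 0 := (hM t htρ x hxρ).trans (le_max_left _ _)
  have hsqrt : Real.sqrt (T - t) < r₁ := by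
    calc Real.sqrt (T - t) < Real.sqrt (r₁ ^ 2) :=
          Real.sqrt_lt_sqrt (by linarith [ht.2]) (by linarith [ht.1])
      _ = r₁ := Real.sqrt_sq hr₁.le
  have hlt : Real.sqrt (T - t) * ‖u t x‖ < c' * s := by
    calc Real.sqrt (T - t) * ‖u t x‖ ≤ Real.sqrt (T - t) * max M 0 :=
          mul_le_mul_of_nonneg_left hub (Real.sqrt_nonneg _)
      _ < r₁ * (max M 0 + 1) := by
          have h0 : 0 ≤ max M 0 := le_max_right _ _
          nlinarith [Real.sqrt_nonneg (T - t)]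
      _ ≤ c' * s := hr₁s
  exact absurd (hux.trans_lt hlt) (lt_irrefl _)

/-- **The constant of H is at least `c' δ^{-2/3}`.** There are absolute `δ₀, c' > 0` such that if a
standing solution is cofinally `δ`-mixing at `(T, x₀)` (`0 < δ ≤ δ₀`) AND obeys the Type-I(K)
velocity bound `√(T − t)‖u(t,x)‖ ≤ K` on some parabolic cylinder at `(T, x₀)` — the conclusion of
the open heart H (`stub_mixingForcesTypeI`) of line `birth` — then `c' δ^{-2/3} ≤ K`
(`mixingPayoff_typeIRatio_lower_bound` inside that cylinder). So any witness `(δ, K)` of H that is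
ever instantiated satisfies `K ≥ c' δ^{-2/3}`. -/
theorem mixingPayoff_typeI_constant_lower_bound :
    ∃ δ₀ : ℝ, 0 < δ₀ ∧ ∃ c' : ℝ, 0 < c' ∧
    ∀ (T : ℝ) (u : ℝ → E3 → E3) (p : ℝ → E3 → ℝ), 0 < T →
    IsClassicalNSSolutionOn (Set.Ico 0 T) 1 0 u p → IsLerayHopfOn T 1 0 (u 0) u →
    HasRapidSpatialDecay (u 0) →
    ∀ (x₀ : E3) (δ K : ℝ), 0 < δ → δ ≤ δ₀ →
    (∃ r₀ : ℝ, 0 < r₀ ∧ ∀ r ∈ Set.Ioo 0 r₀, DissipatesAtScale u T x₀ r δ) →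
    (∃ r₁ : ℝ, 0 < r₁ ∧ ∀ t ∈ Set.Ioo (T - r₁ ^ 2) T, ∀ x ∈ Metric.ball x₀ r₁,
      Real.sqrt (T - t) * ‖u t x‖ ≤ K) →
    c' * δ ^ (-(2:ℝ) / 3) ≤ K := by
  obtain ⟨δ₀, hδ₀, c', hc', hLB⟩ := mixingPayoff_typeIRatio_lower_bound
  refine ⟨δ₀, hδ₀, c', hc', ?_⟩
  intro T u p hT hcl hLH hdec x₀ δ K hδ hδδ₀ hmix hTI
  obtain ⟨r₁, hr₁, hK⟩ := hTI
  obtain ⟨t, ht, x, hx, hux⟩ := hLB T u p hT hcl hLH hdec x₀ δ hδ hδδ₀ hmix r₁ hr₁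
  exact hux.trans (hK t ht x hx)

end Summit.NavierStokesRegularity.NavierStokesRegularity.Theorems

end
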